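import Literature.NumberTheory.Transcendental.KZLogCalculusProofs
import Literature.NumberTheory.Transcendental.SemialgebraicDerivative
import Literature.NumberTheory.Transcendental.SemialgebraicDerivativeProofs

/-!
# `UnfoldedLogStokes` (stmt-KontsevichZagierPeriods-2835) — line `engine-transport`,
stub `stub_velocityExtension` (zero-extension of the definable fibre velocity)

The tree engine `KZ.unfoldedLogStokes_mem_relations` wants the fibre velocity to be
`ℚ`-semialgebraic on the CLOSED band `KZlog.band τ a b`, whereas the crux only provides it as a
`HasDerivAt` on the OPEN fibres `Ioo (a x) (b x)`. This stub supplies the surrogate: by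
Basu–Pollack–Roy Prop. 3.22 (proved in tree as
`IsSemialgebraicFunOn.hasDerivAt_last_isSemialgebraic_holds`) the velocity `F'` is `ℚ`-semialgebraic
on the open band; extending it by `0` over the two boundary graphs (`IsSemialgebraicFunOn.union`,
the graphs being semialgebraic by `isSemialgebraicFunOn_iff`) gives `F''` semialgebraic on the
closed band and equal to `F'` on open fibres, so the `HasDerivAt` transfers verbatim.
-/

noncomputable section

open MeasureTheory Set
open Literature.NumberTheory.Transcendental
open Literature.ModelTheory.ExponentialFields (IsSemialgebraic)

namespace Summit.KontsevichZagierPeriods.LiouvilleUnfolding.Engine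

/-- **Stub — zero-extension of the definable fibre velocity.** If `F` is `ℚ`-semialgebraic on the
closed band `KZlog.band τ a b` (semialgebraic base `τ`, semialgebraic edges `a`, `b`) and has fibre
derivative `F'` on the open fibres `Ioo (a x) (b x)`, then there is `F''`, `ℚ`-semialgebraic on the
CLOSED band, which is still a fibre derivative of `F` on the open fibres. Proof: `F'` is
`ℚ`-semialgebraic on the open band by Basu–Pollack–Roy Prop. 3.22
(`IsSemialgebraicFunOn.hasDerivAt_last_isSemialgebraic_holds`); put `F'' := F'` there and `F'' := 0`
on the boundary graphs of `a` and `b` (semialgebraic by `isSemialgebraicFunOn_iff`), glued by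
`IsSemialgebraicFunOn.union`; on open fibres `F'' = F'`.
[cite: BasuPollackRoy2006, Prop. 3.22] -/
theorem stub_velocityExtension : ∀ (n : ℕ) (τ : Set (Fin n → ℝ)) (a b : (Fin n → ℝ) → ℝ) (F F' : (Fin (n + 1) → ℝ) → ℝ), Literature.ModelTheory.ExponentialFields.IsSemialgebraic ℚ τ → Literature.NumberTheory.Transcendental.IsSemialgebraicFunOn ℚ τ a → Literature.NumberTheory.Transcendental.IsSemialgebraicFunOn ℚ τ b → Literature.NumberTheory.Transcendental.IsSemialgebraicFunOn ℚ (Literature.NumberTheory.Transcendental.KZlog.band τ a b) F → (∀ x ∈ τ, ∀ t ∈ Set.Ioo (a x) (b x), HasDerivAt (fun s : ℝ => F (Fin.snoc x s)) (F' (Fin.snoc x t)) t) → ∃ F'' : (Fin (n + 1) → ℝ) → ℝ, Literature.NumberTheory.Transcendental.IsSemialgebraicFunOn ℚ (Literature.NumberTheory.Transcendental.KZlog.band τ a b) F'' ∧ ∀ x ∈ τ, ∀ t ∈ Set.Ioo (a x) (b x), HasDerivAt (fun s : ℝ => F (Fin.snoc x s)) (F'' (Fin.snoc x t)) t := by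
  intro n τ a b F F' _hτ ha hb hF hder
  classical
  -- the open band (in the fact's form) and the boundary graphs
  set O : Set (Fin (n + 1) → ℝ) := {z | Fin.init z ∈ τ ∧ a (Fin.init z) < z (Fin.last n) ∧
    z (Fin.last n) < b (Fin.init z)} with hO
  set Ga : Set (Fin (n + 1) → ℝ) := {z | Fin.init z ∈ τ ∧ z (Fin.last n) = a (Fin.init z)} with hGa
  set Gb : Set (Fin (n + 1) → ℝ) := {z | Fin.init z ∈ τ ∧ z (Fin.last n) = b (Fin.init z)} with hGb
  set E : Set (Fin (n + 1) → ℝ) := KZlog.band τ a b ∩ (Ga ∪ Gb) with hE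
  have hGa_sa : IsSemialgebraic ℚ Ga := isSemialgebraicFunOn_iff.mp ha
  have hGb_sa : IsSemialgebraic ℚ Gb := isSemialgebraicFunOn_iff.mp hb
  have hE_sa : IsSemialgebraic ℚ E := (KZlog.isSemialgebraic_band ha hb).inter (hGa_sa.union hGb_sa)
  have hF' : IsSemialgebraicFunOn ℚ O F' :=
    IsSemialgebraicFunOn.hasDerivAt_last_isSemialgebraic_holds n τ a b F F' ha hb hF hder
  -- the extension
  set F'' : (Fin (n + 1) → ℝ) → ℝ := fun z => if z ∈ O then F' z else 0 with hF''
  have hfs : EqOn F'' F' O := fun z hz => by simp [hF'', hz]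
  have hnot : ∀ z ∈ E, z ∉ O := by
    rintro z ⟨-, hz | hz⟩ hzO
    · exact (lt_irrefl _) (hz.2 ▸ hzO.2.1)
    · exact (lt_irrefl _) (hz.2 ▸ hzO.2.2)
  have hgt : EqOn F'' (fun _ => (0 : ℝ)) E := fun z hz => by simp [hF'', hnot z hz]
  have hzero : IsSemialgebraicFunOn ℚ E (fun _ => (0 : ℝ)) := by
    simpa using isSemialgebraicFunOn_ratCast hE_sa 0
  have hunion : IsSemialgebraicFunOn ℚ (O ∪ E) F'' := IsSemialgebraicFunOn.union hF' hzero hfs hgt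
  have hOE : O ∪ E = KZlog.band τ a b := by
    ext z
    simp only [hO, hE, hGa, hGb, KZlog.mem_band, mem_union, mem_inter_iff, mem_setOf_eq]
    constructor
    · rintro (⟨h1, h2, h3⟩ | ⟨h1, -⟩)
      · exact ⟨h1, h2.le, h3.le⟩
      · exact h1
    · rintro ⟨h1, h2, h3⟩
      rcases h2.lt_or_eq with h2' | h2'
      · rcases h3.lt_or_eq with h3' | h3'
        · exact Or.inl ⟨h1, h2', h3'⟩
        · exact Or.inr ⟨⟨h1, h2, h3⟩, Or.inr ⟨h1, h3'⟩⟩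
      · exact Or.inr ⟨⟨h1, h2, h3⟩, Or.inl ⟨h1, h2'.symm⟩⟩
  refine ⟨F'', hOE ▸ hunion, fun x hx t ht => ?_⟩
  have hmem : (Fin.snoc x t : Fin (n + 1) → ℝ) ∈ O := by
    simp only [hO, mem_setOf_eq, Fin.init_snoc, Fin.snoc_last]
    exact ⟨hx, ht.1, ht.2⟩
  rw [hfs hmem]
  exact hder x hx t ht

end Summit.KontsevichZagierPeriods.LiouvilleUnfolding.Engine
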